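import Mathlib.MeasureTheory.Integral.Pi
import Mathlib.MeasureTheory.Integral.Bochner.SumMeasure
import Mathlib.Analysis.Convex.Integral
import Mathlib.Probability.Independence.Basic
import Mathlib.MeasureTheory.Measure.Decomposition.RadonNikodym
import Literature.Analysis.Potential.CircleLogKernel
import Literature.Barriers.QuantumFields.GrossWittenTransition
import Literature.MathematicalPhysics.KineticTheory.HardSphereEulerProofs
import HarnessLib

/-!
# The Gross–Witten Coulomb gas: mean-field bounds for the `U(N)` one-plaquette integral

Sibling proof file of `GrossWittenTransition.lean` (`Literature/Barriers/QuantumFields/`, D-0021;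
namespace `Literature.Barriers.QuantumFields`), layer 2 of the discharge of the named fact
`Literature.Barriers.QuantumFields.GrossWittenLargeNFreeEnergy` (Johansson 1998, Lemma 2.1 [GW]:
`n⁻² log G_n(γ) → f(γ)`), by an elementary potential-theoretic ("Coulomb gas") sandwich rather than
Johansson's loop-equation/Toeplitz route (§3 of the paper, which needs the determinantal structure
of the unitary ensemble). The finite-`n` object is exactly the integral of the named fact,
`gwPartitionFunction n γ = ((2π)ⁿ n!)⁻¹ ∫_{[-π,π]ⁿ} ∏_{j<k}|e^{iθ_j} − e^{iθ_k}|² e^{γ n ∑ cos θ_j} dθ`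
("the partition function of a Coulomb gas of unit charges on the unit circle with logarithmic
repulsion and an external potential", Johansson p. 65).

## What this file proves (all theorems; [folklore] = the classical mean-field argument)

Let `ℓ(v) = log |1 − e^{iv}|`, `U^μ`, `E(μ)`, `ℓ_r`, `U_r^μ`, `E_r`, `η(r)` be the angular logarithmic
kernel, potentials, energies and their Poisson regularisations of
`Literature.Analysis.Potential.CircleLogKernel`.

* `GWFrostmanData γ` — the hypothesis structure consumed by both bounds: a probability measure `μ`
  on angles with `μ ≤ M · vol|[-π,π]`, a constant `ℓ_F`, the Frostman inequality
  `γ cos t + 2 U^μ(t) ≤ ℓ_F` for all `t`, and the Frostman identity `γ ∫cos dμ + 2 E(μ) = ℓ_F`;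
  `d.freeEnergy = γ ∫cos dμ + E(μ)`. (Inhabited for every `γ ≥ 0` in `GrossWittenEquilibrium.lean`.)
* `cueWeight_eq_exp`, `log_cueWeight_le`: off collisions the Vandermonde weight is
  `exp ∑_{i≠j} ℓ(θ_i − θ_j)` and, after regularisation (L1) and symmetrisation,
  `log ∏ ≤ ∑_{i,j} ℓ_r(θ_i−θ_j) − n log(1−r) − n² log r`.
* `weight_le` (UPPER, pointwise): `∏_{i<j}|e^{iθ_i}−e^{iθ_j}|² e^{γn∑cos θ_j}
  ≤ exp (n²(F(μ) + 2Mη(r) + 2 log r⁻¹) + n log (1−r)⁻¹)` — negative type of `ℓ_r` (L3) to compare the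
  empirical measure with `n μ`, smoothing (L4) `U_r^μ ≤ U^μ + Mη(r)`, the energy comparison
  `E ≤ E_r − (log r)/2`, and Frostman at each particle; hence `gwPartitionFunction_le`,
  `gwFreeEnergyN_le`.
* `exp_le_gwPartitionFunction` (LOWER): `(2π)ⁿ n! G_n ≥ M⁻ⁿ exp (γ n² ∫cos dμ + (n²−n) E(μ))` —
  Gibbs' variational principle, i.e. Jensen's inequality for `exp` under the trial state `μ^{⊗n}`
  (whose density on the box is `≤ Mⁿ`: `pi_le_smul_pi`, via a bounded version of the Radon–Nikodym
  density and `pi_withDensity_eq`), with the collision set `μ^{⊗n}`-null (`ae_cueWeight_ne_zero`)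
  and the two-particle marginal `μ ⊗ μ` (`pi_map_pair`); hence `gwPartitionFunction_pos`,
  `le_gwFreeEnergyN`.
* `GWFrostmanData.tendsto_gwFreeEnergyN`: **`gwFreeEnergyN n γ → d.freeEnergy`** (squeeze with the
  regularisation schedule `r_n = n/(n+1)`; errors `O(η(r_n) + log(1+1/n) + (log n)/n)`).

## Design choices

* The equilibrium measure enters ONLY through `GWFrostmanData`; no variational problem is solved
  here (existence/uniqueness of equilibrium measures is not needed for the limit, only one explicit
  Frostman datum per `γ`).
* Angles stay on `ℝ`; the trial state is `Measure.pi`; the empirical measure is the finite sum of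
  Dirac masses `empiricalMeasure θ` (un-normalised, compared with `n • μ` — L3 needs no mass
  condition).
* Constants are not optimised (`2 log r⁻¹` instead of `(3/2) log r⁻¹`, `4^{n²}` weight bound).

## References

* K. Johansson, Math. Res. Lett. 5 (1998) 63–82 — Lemma 2.1 and p. 65 (the Coulomb-gas reading).
* E. B. Saff, V. Totik, *Logarithmic Potentials with External Fields*, Springer 1997, Ch. I
  (Frostman inequalities; the mean-field sandwich is the standard discrete-to-continuous energy
  argument) — background only, nothing is cited as a fact.
-/

noncomputable section

open MeasureTheory Filter Set Complex intervalIntegral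
open scoped Topology Real

namespace Literature.Barriers.QuantumFields

open Literature.Analysis.Potential
open scoped ENNReal NNReal

/-! ### Frostman data for the external field `γ cos` -/

/-- **Frostman (equilibrium) data for the Gross–Witten Coulomb gas at coupling `γ`.** A probability
measure `μ` on the angle axis, dominated by `M ·` Lebesgue on `[-π, π]`, together with a constant
`ℓ_F` such that the effective potential `V = γ cos + 2 U^μ` satisfies the Frostman inequality
`V ≤ ℓ_F` everywhere and the Frostman identity `∫ V dμ = ℓ_F` (written out as
`γ ∫cos dμ + 2 E(μ) = ℓ_F`). For the equilibrium measure of the energy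
`I(μ) = −γ ∫cos dμ − E(μ)` these are the Euler–Lagrange conditions (`V = ℓ_F` on `supp μ`); here
they are simply hypotheses, inhabited explicitly in `GrossWittenEquilibrium.lean`. [folklore] -/
structure GWFrostmanData (γ : ℝ) where
  /-- the (equilibrium) probability measure on angles -/
  μ : Measure ℝ
  isProb : IsProbabilityMeasure μ
  /-- a bound for its density on `[-π, π]` -/
  M : ℝ
  le_smul : μ ≤ ENNReal.ofReal M • volume.restrict (Set.Icc (-π) π)
  /-- the Frostman constant -/
  ℓF : ℝ
  frostman_le : ∀ t : ℝ, γ * Real.cos t + 2 * circleLogPotential μ t ≤ ℓF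
  frostman_eq : γ * (∫ t, Real.cos t ∂μ) + 2 * circleLogEnergy μ = ℓF

namespace GWFrostmanData

variable {γ : ℝ} (d : GWFrostmanData γ)

/-- The value of the free-energy functional `F(μ) = γ ∫cos dμ + E(μ)` at the datum — the common
limit of the upper and lower bounds below. [folklore] -/
def freeEnergy : ℝ := γ * (∫ t, Real.cos t ∂d.μ) + circleLogEnergy d.μ

/-- `ℓ_F − E(μ) = F(μ)` (from the Frostman identity). [folklore] -/
theorem ℓF_sub_energy : d.ℓF - circleLogEnergy d.μ = d.freeEnergy := by
  have := d.frostman_eq; unfold freeEnergy; linarith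

/-- The density bound is positive (a probability measure is not dominated by `0`). [folklore] -/
theorem M_pos : 0 < d.M := by
  by_contra h
  push Not at h
  have h0 : d.μ ≤ 0 := by simpa [ENNReal.ofReal_of_nonpos h] using d.le_smul
  have h1 : d.μ Set.univ = 0 := le_antisymm (h0 Set.univ) bot_le
  haveI := d.isProb
  simp at h1

end GWFrostmanData

variable {γ : ℝ}

/-! ### The Vandermonde weight as a Coulomb energy -/

/-- `|e^{ia} − e^{ib}| = |1 − e^{i(b−a)}|`. [folklore] -/
theorem norm_exp_sub_exp (a b : ℝ) :
    ‖cexp (a * I) - cexp (b * I)‖ = ‖1 - cexp (((b - a : ℝ) : ℂ) * I)‖ := by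
  have : cexp (a * I) - cexp (b * I) = cexp (a * I) * (1 - cexp (((b - a : ℝ) : ℂ) * I)) := by
    rw [mul_sub, mul_one, ← Complex.exp_add]; push_cast; ring_nf
  rw [this, norm_mul, Complex.norm_exp_ofReal_mul_I, one_mul]

/-- Off the collision set the Vandermonde weight is the exponential of the pair Coulomb energy:
`∏_{i<j} |e^{iθ_i} − e^{iθ_j}|² = exp (∑_{i<j} 2 ℓ(θ_j − θ_i))`. [folklore] -/
theorem cueWeight_eq_exp {n : ℕ} (θ : Fin n → ℝ) (h : cueWeight n θ ≠ 0) :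
    cueWeight n θ = Real.exp (∑ i, ∑ j ∈ Finset.Ioi i, 2 * circleLogKernel (θ j - θ i)) := by
  unfold cueWeight at h ⊢
  rw [Real.exp_sum]
  refine Finset.prod_congr rfl fun i _ => ?_
  rw [Real.exp_sum]
  refine Finset.prod_congr rfl fun j hj => ?_
  have hij : ‖cexp (θ i * I) - cexp (θ j * I)‖ ^ 2 ≠ 0 := by
    intro h0
    apply h
    exact Finset.prod_eq_zero (Finset.mem_univ i) (Finset.prod_eq_zero hj h0)
  have hpos : 0 < ‖cexp (θ i * I) - cexp (θ j * I)‖ := by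
    rcases (norm_nonneg (cexp (θ i * I) - cexp (θ j * I))).eq_or_lt with h1 | h1
    · exact absurd (by rw [← h1]; ring) hij
    · exact h1
  have h2 : 2 * circleLogKernel (θ j - θ i) = Real.log (‖cexp (θ i * I) - cexp (θ j * I)‖ ^ 2) := by
    rw [circleLogKernel, ← norm_exp_sub_exp, Real.log_pow]; norm_num
  rw [h2, Real.exp_log (by positivity)]

/-- A factor of a non-vanishing Vandermonde weight is off `2πℤ`. [folklore] -/
theorem exp_sub_ne_one_of_cueWeight_ne_zero {n : ℕ} {θ : Fin n → ℝ} (h : cueWeight n θ ≠ 0)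
    {i j : Fin n} (hj : j ∈ Finset.Ioi i) : cexp (((θ j - θ i : ℝ) : ℂ) * I) ≠ 1 := by
  intro h1
  apply h
  unfold cueWeight
  refine Finset.prod_eq_zero (Finset.mem_univ i) (Finset.prod_eq_zero hj ?_)
  rw [norm_exp_sub_exp, h1, sub_self, norm_zero]
  ring

/-- Symmetrisation of a sum over ordered pairs: for symmetric `g`,
`2 ∑_{i<j} g i j = ∑_{i,j} g i j − ∑_i g i i`. [folklore] -/
theorem two_mul_sum_sum_Ioi {n : ℕ} (g : Fin n → Fin n → ℝ) (hg : ∀ i j, g i j = g j i) :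
    2 * ∑ i, ∑ j ∈ Finset.Ioi i, g i j = (∑ i, ∑ j, g i j) - ∑ i, g i i := by
  have h := Finset.sum_sum_Ioi_add_eq_sum_sum_off_diag g
  have h1 : ∑ i, ∑ j ∈ Finset.Ioi i, (g j i + g i j) = 2 * ∑ i, ∑ j ∈ Finset.Ioi i, g i j := by
    rw [Finset.mul_sum]
    refine Finset.sum_congr rfl fun i _ => ?_
    rw [Finset.mul_sum]
    refine Finset.sum_congr rfl fun j _ => ?_
    rw [hg j i]; ring
  have h2 : ∑ i, ∑ j ∈ ({i}ᶜ : Finset (Fin n)), g j i = (∑ i, ∑ j, g i j) - ∑ i, g i i := by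
    rw [← Finset.sum_sub_distrib]
    refine Finset.sum_congr rfl fun i _ => ?_
    have := Finset.sum_compl_add_sum {i} fun j => g j i
    rw [Finset.sum_singleton] at this
    have h3 : ∑ j, g j i = ∑ j, g i j := Finset.sum_congr rfl fun j _ => hg j i
    linarith
  rw [← h1, h, h2]

/-- **Regularised pair energy bounds the Vandermonde weight.** For `0 < r ≤ 1` and a
non-vanishing weight,
`log ∏_{i<j}|e^{iθ_i} − e^{iθ_j}|² ≤ ∑_{i,j} ℓ_r(θ_i − θ_j) − n log (1−r) − n² log r`
(L1 on each pair, then symmetrisation; the diagonal terms are `ℓ_r(0) = log (1−r)`). [folklore] -/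
theorem log_cueWeight_le {n : ℕ} (θ : Fin n → ℝ) (h : cueWeight n θ ≠ 0) {r : ℝ} (hr0 : 0 < r)
    (hr1 : r < 1) :
    Real.log (cueWeight n θ) ≤ (∑ i, ∑ j, circleLogKernelR r (θ i - θ j))
      - n * Real.log (1 - r) - (n : ℝ) ^ 2 * Real.log r := by
  have hlogr : Real.log r ≤ 0 := Real.log_nonpos hr0.le hr1.le
  rw [cueWeight_eq_exp θ h, Real.log_exp]
  -- L1 on each pair
  have h1 : ∑ i, ∑ j ∈ Finset.Ioi i, 2 * circleLogKernel (θ j - θ i) ≤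
      ∑ i, ∑ j ∈ Finset.Ioi i, (2 * circleLogKernelR r (θ j - θ i) - Real.log r) := by
    refine Finset.sum_le_sum fun i _ => Finset.sum_le_sum fun j hj => ?_
    have := circleLogKernel_add_le hr0 (exp_sub_ne_one_of_cueWeight_ne_zero h hj)
    linarith
  -- counting the pairs
  have h2 : ∑ i, ∑ j ∈ Finset.Ioi i, (2 * circleLogKernelR r (θ j - θ i) - Real.log r) =
      2 * (∑ i, ∑ j ∈ Finset.Ioi i, circleLogKernelR r (θ j - θ i))
        - (∑ i : Fin n, ((Finset.Ioi i).card : ℝ)) * Real.log r := by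
    simp only [Finset.sum_sub_distrib, Finset.sum_const, nsmul_eq_mul, Finset.mul_sum,
      Finset.sum_mul]
  have h3 : (∑ i : Fin n, ((Finset.Ioi i).card : ℝ)) ≤ (n : ℝ) ^ 2 := by
    calc (∑ i : Fin n, ((Finset.Ioi i).card : ℝ)) ≤ ∑ _i : Fin n, (n : ℝ) := by
          refine Finset.sum_le_sum fun i _ => ?_
          exact_mod_cast (Finset.card_le_univ (Finset.Ioi i)).trans_eq (Fintype.card_fin n)
      _ = (n : ℝ) ^ 2 := by simp [sq]
  -- symmetrisation
  have h4 := two_mul_sum_sum_Ioi (fun i j => circleLogKernelR r (θ i - θ j))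
    (fun i j => circleLogKernelR_sub_comm r (θ i) (θ j))
  simp only [sub_self] at h4
  have h5 : circleLogKernelR r 0 = Real.log (1 - r) := by
    rw [circleLogKernelR]
    simp only [Complex.ofReal_zero, zero_mul, Complex.exp_zero, mul_one]
    rw [show (1 : ℂ) - (r : ℂ) = ((1 - r : ℝ) : ℂ) by push_cast; ring, Complex.norm_real,
      Real.norm_eq_abs, abs_of_nonneg (by linarith)]
  have h6 : ∑ i, ∑ j ∈ Finset.Ioi i, circleLogKernelR r (θ j - θ i) =
      ∑ i, ∑ j ∈ Finset.Ioi i, circleLogKernelR r (θ i - θ j) := by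
    refine Finset.sum_congr rfl fun i _ => Finset.sum_congr rfl fun j _ => ?_
    exact circleLogKernelR_sub_comm r _ _
  rw [h6] at h2
  rw [h5, Finset.sum_const, Finset.card_univ, Fintype.card_fin, nsmul_eq_mul] at h4
  nlinarith [h1, h2, h3, h4, hlogr]

/-! ### The empirical measure of a configuration -/

/-- The (un-normalised) empirical measure `∑_j δ_{θ_j}` of a configuration. [folklore] -/
def empiricalMeasure {n : ℕ} (θ : Fin n → ℝ) : Measure ℝ := ∑ j, Measure.dirac (θ j)

/-- The empirical measure is finite (mass `n`). [folklore] -/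
instance {n : ℕ} (θ : Fin n → ℝ) : IsFiniteMeasure (empiricalMeasure θ) := by
  unfold empiricalMeasure; infer_instance

/-- Integration against the empirical measure is summation over the particles. [folklore] -/
theorem integral_empiricalMeasure {n : ℕ} (θ : Fin n → ℝ) (f : ℝ → ℝ) :
    ∫ x, f x ∂(empiricalMeasure θ) = ∑ j, f (θ j) := by
  rw [empiricalMeasure, integral_finsetSum_measure fun j _ =>
    (integrable_const (f (θ j))).congr (ae_eq_dirac f).symm]
  simp [integral_dirac]

/-- `U_r^{emp θ}(t) = ∑_j ℓ_r(t − θ_j)`. [folklore] -/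
theorem circleLogPotentialR_empiricalMeasure {n : ℕ} (θ : Fin n → ℝ) (r t : ℝ) :
    circleLogPotentialR (empiricalMeasure θ) r t = ∑ j, circleLogKernelR r (t - θ j) := by
  rw [circleLogPotentialR, integral_empiricalMeasure]

/-- `E_r(emp θ, emp θ) = ∑_{i,j} ℓ_r(θ_i − θ_j)`. [folklore] -/
theorem circleLogEnergyR_empiricalMeasure {n : ℕ} (θ : Fin n → ℝ) (r : ℝ) :
    circleLogEnergyR (empiricalMeasure θ) (empiricalMeasure θ) r =
      ∑ i, ∑ j, circleLogKernelR r (θ i - θ j) := by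
  rw [circleLogEnergyR, integral_empiricalMeasure]
  simp_rw [circleLogPotentialR_empiricalMeasure]

/-- `U_r^{c μ} = c U_r^{μ}`. [folklore] -/
theorem circleLogPotentialR_smul (μ : Measure ℝ) (c : ℝ≥0) (r t : ℝ) :
    circleLogPotentialR (c • μ) r t = c * circleLogPotentialR μ r t := by
  rw [circleLogPotentialR, circleLogPotentialR, integral_smul_nnreal_measure]; rfl

/-- `E_r(emp θ, c μ) = c ∑_i U_r^μ(θ_i)`. [folklore] -/
theorem circleLogEnergyR_empiricalMeasure_smul {n : ℕ} (θ : Fin n → ℝ) (μ : Measure ℝ) (c : ℝ≥0)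
    (r : ℝ) : circleLogEnergyR (empiricalMeasure θ) (c • μ) r =
      c * ∑ i, circleLogPotentialR μ r (θ i) := by
  rw [circleLogEnergyR, integral_empiricalMeasure, Finset.mul_sum]
  simp_rw [circleLogPotentialR_smul]

/-- `E_r(c μ, c μ) = c² E_r(μ, μ)`. [folklore] -/
theorem circleLogEnergyR_smul_smul (μ : Measure ℝ) (c : ℝ≥0) (r : ℝ) :
    circleLogEnergyR (c • μ) (c • μ) r = (c : ℝ) ^ 2 * circleLogEnergyR μ μ r := by
  rw [circleLogEnergyR, circleLogEnergyR, integral_smul_nnreal_measure]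
  simp_rw [circleLogPotentialR_smul]
  rw [MeasureTheory.integral_const_mul]
  simp [NNReal.smul_def]; ring

/-! ### The upper bound: Frostman's inequality for the finite gas -/

/-- **Pointwise bound on the Gibbs weight (the heart of the upper bound).** For Frostman data
`d` at coupling `γ`, `n ≥ 1` particles, and a regularisation parameter `0 < r < 1`:
`∏_{i<j}|e^{iθ_i} − e^{iθ_j}|² e^{γ n ∑ cos θ_j} ≤ exp (n² (F(μ) + 2 M η(r) + 2 log r⁻¹) + n log (1−r)⁻¹)`,
obtained from L1 (regularise), L3 (compare the empirical measure with `n μ`), L4 (de-regularise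
the cross term) and the Frostman inequality `γ cos + 2U^μ ≤ ℓ_F` at each particle. [folklore] -/
theorem weight_le (d : GWFrostmanData γ) {n : ℕ} (θ : Fin n → ℝ) {r : ℝ} (hr0 : 0 < r)
    (hr1 : r < 1) :
    cueWeight n θ * Real.exp (γ * n * ∑ j, Real.cos (θ j)) ≤
      Real.exp ((n : ℝ) ^ 2 * (d.freeEnergy + 2 * d.M * circleLogExcess r + 2 * Real.log r⁻¹)
        + n * Real.log (1 - r)⁻¹) := by
  haveI := d.isProb
  by_cases h0 : cueWeight n θ = 0
  · rw [h0, zero_mul]; positivity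
  have hlogr : Real.log r ≤ 0 := Real.log_nonpos hr0.le hr1.le
  have hM := d.M_pos
  have hη := circleLogExcess_nonneg r
  -- (L1) + symmetrisation
  have h1 := log_cueWeight_le θ h0 hr0 hr1
  -- (L3) with the empirical measure and `n • μ`
  have h3 := circleLogEnergyR_add_le (μ := empiricalMeasure θ) (ν := (n : ℝ≥0) • d.μ) hr0.le hr1
  rw [circleLogEnergyR_empiricalMeasure, circleLogEnergyR_smul_smul,
    circleLogEnergyR_empiricalMeasure_smul] at h3
  push_cast at h3
  -- (L4) at each particle, and the energy comparison (mass 1)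
  have h4 : ∀ i, circleLogPotentialR d.μ r (θ i) ≤
      circleLogPotential d.μ (θ i) + d.M * circleLogExcess r :=
    fun i => circleLogPotentialR_le hM.le d.le_smul hr0 hr1 (θ i)
  have h5 := circleLogEnergy_add_le_circleLogEnergyR hM.le d.le_smul hr0 hr1
  simp only [probReal_univ, one_pow, mul_one] at h5
  -- Frostman at each particle
  have h6 : ∑ i, (γ * Real.cos (θ i) + 2 * circleLogPotential d.μ (θ i)) ≤ n * d.ℓF := by
    calc _ ≤ ∑ _i : Fin n, d.ℓF := Finset.sum_le_sum fun i _ => d.frostman_le (θ i)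
      _ = n * d.ℓF := by simp
  have h4' : ∑ i, circleLogPotentialR d.μ r (θ i) ≤
      ∑ i, circleLogPotential d.μ (θ i) + n * (d.M * circleLogExcess r) := by
    calc _ ≤ ∑ i, (circleLogPotential d.μ (θ i) + d.M * circleLogExcess r) :=
          Finset.sum_le_sum fun i _ => h4 i
      _ = _ := by rw [Finset.sum_add_distrib]; simp
  -- assemble the exponent
  have hF := d.ℓF_sub_energy
  have hkey : Real.log (cueWeight n θ) + γ * n * ∑ j, Real.cos (θ j) ≤
      (n : ℝ) ^ 2 * (d.freeEnergy + 2 * d.M * circleLogExcess r + 2 * Real.log r⁻¹)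
        + n * Real.log (1 - r)⁻¹ := by
    rw [Real.log_inv, Real.log_inv]
    have hsum : γ * ↑n * ∑ j, Real.cos (θ j) + 2 * n * ∑ i, circleLogPotential d.μ (θ i) =
        n * ∑ i, (γ * Real.cos (θ i) + 2 * circleLogPotential d.μ (θ i)) := by
      rw [Finset.sum_add_distrib, ← Finset.mul_sum, ← Finset.mul_sum]; ring
    have hn : (0 : ℝ) ≤ n := Nat.cast_nonneg n
    have hn2 : (0 : ℝ) ≤ (n : ℝ) ^ 2 := by positivity
    nlinarith [h1, h3, h4', h5, h6, hsum, mul_nonneg hn (mul_nonneg hM.le hη),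
      mul_nonneg hn2 (neg_nonneg.2 hlogr)]
  -- exponentiate
  have hpos : 0 < cueWeight n θ := lt_of_le_of_ne (cueWeight_nonneg n θ) (Ne.symm h0)
  calc cueWeight n θ * Real.exp (γ * n * ∑ j, Real.cos (θ j))
      = Real.exp (Real.log (cueWeight n θ) + γ * n * ∑ j, Real.cos (θ j)) := by
        rw [Real.exp_add, Real.exp_log hpos]
    _ ≤ _ := Real.exp_le_exp.2 hkey

/-- The Lebesgue measure of the eigenvalue box is `(2π)ⁿ`. [folklore] -/
theorem volume_eigenBox (n : ℕ) : volume (eigenBox n) = ENNReal.ofReal ((2 * π) ^ n) := by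
  rw [eigenBox, volume_pi_pi]
  simp only [Real.volume_Icc, Finset.prod_const, Finset.card_univ, Fintype.card_fin]
  rw [show π - -π = 2 * π by ring, ENNReal.ofReal_pow (by positivity)]

/-- **Upper bound for the partition function** `G_n(γ) ≤ exp (n²(F + 2Mη(r) + 2 log r⁻¹) + n log (1−r)⁻¹)`
(integrate `weight_le` over the box of volume `(2π)ⁿ` and drop `1/n! ≤ 1`). [folklore] -/
theorem gwPartitionFunction_le (d : GWFrostmanData γ) (n : ℕ) {r : ℝ} (hr0 : 0 < r) (hr1 : r < 1) :
    gwPartitionFunction n γ ≤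
      Real.exp ((n : ℝ) ^ 2 * (d.freeEnergy + 2 * d.M * circleLogExcess r + 2 * Real.log r⁻¹)
        + n * Real.log (1 - r)⁻¹) := by
  set B := (n : ℝ) ^ 2 * (d.freeEnergy + 2 * d.M * circleLogExcess r + 2 * Real.log r⁻¹)
        + n * Real.log (1 - r)⁻¹ with hB
  have hint : ∫ θ in eigenBox n, cueWeight n θ * Real.exp (γ * n * ∑ j, Real.cos (θ j)) ≤
      Real.exp B * (2 * π) ^ n := by
    have h := norm_setIntegral_le_of_norm_le_const (μ := volume) (s := eigenBox n)
      (f := fun θ => cueWeight n θ * Real.exp (γ * n * ∑ j, Real.cos (θ j))) (C := Real.exp B)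
      (by rw [volume_eigenBox]; exact ENNReal.ofReal_lt_top) fun θ _ => by
        rw [Real.norm_eq_abs, abs_of_nonneg (mul_nonneg (cueWeight_nonneg n θ) (Real.exp_nonneg _))]
        exact weight_le d θ hr0 hr1
    rw [measureReal_def, volume_eigenBox, ENNReal.toReal_ofReal (by positivity)] at h
    exact (le_abs_self _).trans h
  unfold gwPartitionFunction
  have hfac : (1 : ℝ) ≤ n.factorial := by exact_mod_cast Nat.one_le_iff_ne_zero.2 (Nat.factorial_ne_zero n)
  have hpow : (0 : ℝ) < (2 * π) ^ n := by positivity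
  calc ((2 * π) ^ n * (n.factorial : ℝ))⁻¹ *
        ∫ θ in eigenBox n, cueWeight n θ * Real.exp (γ * n * ∑ j, Real.cos (θ j))
      ≤ ((2 * π) ^ n * (n.factorial : ℝ))⁻¹ * (Real.exp B * (2 * π) ^ n) := by
        gcongr
    _ = Real.exp B / n.factorial := by field_simp
    _ ≤ Real.exp B := div_le_self (Real.exp_nonneg _) hfac

/-- **Upper bound for the free energy per particle pair**: if `G_n(γ) > 0` then for every
`0 < r < 1`, `f_n(γ) ≤ F(μ) + 2 M η(r) + 2 log r⁻¹ + (log (1−r)⁻¹)/n`. [folklore] -/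
theorem gwFreeEnergyN_le (d : GWFrostmanData γ) {n : ℕ} (hn : 1 ≤ n)
    (hpos : 0 < gwPartitionFunction n γ) {r : ℝ} (hr0 : 0 < r) (hr1 : r < 1) :
    gwFreeEnergyN n γ ≤ d.freeEnergy + 2 * d.M * circleLogExcess r + 2 * Real.log r⁻¹
      + Real.log (1 - r)⁻¹ / n := by
  have h := Real.log_le_log hpos (gwPartitionFunction_le d n hr0 hr1)
  rw [Real.log_exp] at h
  have hn' : (0 : ℝ) < n := by exact_mod_cast hn
  unfold gwFreeEnergyN
  rw [div_le_iff₀ (by positivity)]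
  have : (d.freeEnergy + 2 * d.M * circleLogExcess r + 2 * Real.log r⁻¹ + Real.log (1 - r)⁻¹ / ↑n) *
      (n : ℝ) ^ 2 = (n : ℝ) ^ 2 * (d.freeEnergy + 2 * d.M * circleLogExcess r + 2 * Real.log r⁻¹)
        + n * Real.log (1 - r)⁻¹ := by
    field_simp
  rw [this]; exact h

/-! ### The lower bound: Gibbs' variational principle with the trial state `μ^{⊗n}` -/

section LowerBound

variable {n : ℕ}

/-- A bounded measurable real function is integrable against a finite measure (any measurable
space). [folklore] -/
theorem integrable_of_forall_abs_le {α : Type*} [MeasurableSpace α] {Q : Measure α}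
    [IsFiniteMeasure Q] {f : α → ℝ} (hf : Measurable f) {C : ℝ} (hC : ∀ x, |f x| ≤ C) :
    Integrable f Q :=
  (integrable_const C).mono' hf.aestronglyMeasurable (ae_of_all _ fun x => by
    rw [Real.norm_eq_abs]; exact hC x)

/-- `|∑_j cos θ_j| ≤ n`. [folklore] -/
theorem abs_sum_cos_le (θ : Fin n → ℝ) : |∑ j, Real.cos (θ j)| ≤ n := by
  calc |∑ j, Real.cos (θ j)| ≤ ∑ j, |Real.cos (θ j)| := Finset.abs_sum_le_sum_abs _ _
    _ ≤ ∑ _j : Fin n, (1 : ℝ) := Finset.sum_le_sum fun j _ => Real.abs_cos_le_one _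
    _ = n := by simp

/-- A measure dominated by `M ·` Lebesgue on `[-π, π]` has a density `ρ ≤ M` (a bounded version of
its Radon–Nikodym derivative). [folklore] -/
theorem exists_density_of_le_smul {μ : Measure ℝ} [IsFiniteMeasure μ] {M : ℝ}
    (hμ : μ ≤ ENNReal.ofReal M • volume.restrict (Icc (-π) π)) :
    ∃ ρ : ℝ → ℝ≥0∞, Measurable ρ ∧ (∀ x, ρ x ≤ ENNReal.ofReal M) ∧
      (volume.restrict (Icc (-π) π)).withDensity ρ = μ := by
  set ν : Measure ℝ := volume.restrict (Icc (-π) π) with hν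
  haveI : IsFiniteMeasure ν := ⟨by
    rw [hν, Measure.restrict_apply MeasurableSet.univ, univ_inter, Real.volume_Icc]
    exact ENNReal.ofReal_lt_top⟩
  have hac : μ ≪ ν := Measure.absolutelyContinuous_of_le_smul hμ
  have hρ₀ : ν.withDensity (μ.rnDeriv ν) = μ := Measure.withDensity_rnDeriv_eq μ ν hac
  have hle : μ.rnDeriv ν ≤ᵐ[ν] fun _ => ENNReal.ofReal M := by
    refine ae_le_of_forall_setLIntegral_le_of_sigmaFinite (Measure.measurable_rnDeriv μ ν)
      fun t ht _ => ?_
    rw [← withDensity_apply _ ht, hρ₀, setLIntegral_const]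
    have := hμ t
    simpa [Measure.smul_apply] using this
  refine ⟨fun x => min (μ.rnDeriv ν x) (ENNReal.ofReal M),
    (Measure.measurable_rnDeriv μ ν).min measurable_const, fun x => min_le_right _ _, ?_⟩
  refine (withDensity_congr_ae ?_).trans hρ₀
  filter_upwards [hle] with x hx
  exact min_eq_left hx

/-- **Comparison of the trial state with Lebesgue measure.** If `μ ≤ M · vol|[-π,π]` then
`μ^{⊗n} ≤ Mⁿ · (vol|[-π,π])^{⊗n}`. [folklore] -/
theorem pi_le_smul_pi {μ : Measure ℝ} [IsFiniteMeasure μ] {M : ℝ}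
    (hμ : μ ≤ ENNReal.ofReal M • volume.restrict (Icc (-π) π)) (n : ℕ) :
    Measure.pi (fun _ : Fin n => μ) ≤
      (ENNReal.ofReal M) ^ n • Measure.pi (fun _ : Fin n => volume.restrict (Icc (-π) π)) := by
  obtain ⟨ρ, hρm, hρle, hρ⟩ := exists_density_of_le_smul hμ
  have hσ : ∀ _i : Fin n, SigmaFinite ((volume.restrict (Icc (-π) π)).withDensity ρ) := fun _ => by
    rw [hρ]; infer_instance
  have h := Literature.MathematicalPhysics.KineticTheory.pi_withDensity_eq
    (fun _ : Fin n => volume.restrict (Icc (-π) π)) (f := fun _ => ρ) (fun _ => hρm) hσ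
  simp only [hρ] at h
  rw [h, ← withDensity_const]
  refine withDensity_mono (ae_of_all _ fun θ => ?_)
  calc ∏ i, ρ (θ i) ≤ ∏ _i : Fin n, ENNReal.ofReal M := Finset.prod_le_prod' fun i _ => hρle _
    _ = ENNReal.ofReal M ^ n := by simp

variable (μ : Measure ℝ) [IsProbabilityMeasure μ]

/-- Under `μ^{⊗n}` two distinct coordinates have joint law `μ ⊗ μ`. [folklore] -/
theorem pi_map_pair {i j : Fin n} (hij : i ≠ j) :
    (Measure.pi fun _ : Fin n => μ).map (fun θ => (θ i, θ j)) = μ.prod μ := by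
  have hind := ProbabilityTheory.iIndepFun_pi (μ := fun _ : Fin n => μ) (X := fun _ x => x)
    (fun _ => aemeasurable_id)
  have h2 : ProbabilityTheory.IndepFun (fun θ : Fin n → ℝ => θ i) (fun θ => θ j)
      (Measure.pi fun _ : Fin n => μ) := hind.indepFun hij
  rw [(ProbabilityTheory.indepFun_iff_map_prod_eq_prod_map_map (measurable_pi_apply i).aemeasurable
      (measurable_pi_apply j).aemeasurable).1 h2,
    (measurePreserving_eval (fun _ : Fin n => μ) i).map_eq,
    (measurePreserving_eval (fun _ : Fin n => μ) j).map_eq]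

variable {μ}
variable {M : ℝ} (hM : 0 ≤ M) (hμ : μ ≤ ENNReal.ofReal M • volume.restrict (Icc (-π) π))
include hM hμ

/-- The pair kernel `ℓ(s − t)` is integrable for `μ ⊗ μ` (dominated `μ`). [folklore] -/
theorem integrable_circleLogKernel_prod :
    Integrable (fun p : ℝ × ℝ => circleLogKernel (p.1 - p.2)) (μ.prod μ) := by
  refine (integrable_prod_iff (Measurable.aestronglyMeasurable (by fun_prop))).2 ⟨?_, ?_⟩
  · exact ae_of_all _ fun s => integrable_circleLogKernel_sub hμ s
  · have hb : ∀ s, |∫ t, ‖circleLogKernel (s - t)‖ ∂μ| ≤ M * ∫ v in (-π)..π, |circleLogKernel v| := by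
      intro s
      rw [abs_of_nonneg (integral_nonneg fun t => norm_nonneg _)]
      -- same computation as `abs_circleLogPotential_le`, for |ℓ|
      have hint : IntegrableOn (fun t => |circleLogKernel (s - t)|) (Icc (-π) π) := by
        have h := (intervalIntegrable_circleLogKernel_sub' s (-π) π).norm
        rw [intervalIntegrable_iff_integrableOn_Icc_of_le (by linarith [Real.pi_pos])] at h
        simpa only [Real.norm_eq_abs] using h
      have h2 : ∫ t, |circleLogKernel (s - t)| ∂μ ≤
          ∫ t, |circleLogKernel (s - t)| ∂(ENNReal.ofReal M • volume.restrict (Icc (-π) π)) :=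
        integral_mono_measure hμ (ae_of_all _ fun t => abs_nonneg _)
          (Integrable.smul_measure hint ENNReal.ofReal_ne_top)
      rw [MeasureTheory.integral_smul_measure, ENNReal.toReal_ofReal hM, smul_eq_mul] at h2
      have h3 : ∫ t in Icc (-π) π, |circleLogKernel (s - t)| = ∫ v in (-π)..π, |circleLogKernel v| := by
        rw [integral_Icc_eq_integral_Ioc, ← intervalIntegral.integral_of_le (by linarith [Real.pi_pos]),
          intervalIntegral.integral_comp_sub_left (fun v => |circleLogKernel v|) s,
          show s - -π = (s - π) + 2 * π by ring]
        have hp : Function.Periodic (fun x => |circleLogKernel x|) (2 * π) := fun x => by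
          simp only [periodic_circleLogKernel x]
        rw [hp.intervalIntegral_add_eq (s - π) (-π), show -π + 2 * π = π by ring]
      simp only [Real.norm_eq_abs]
      rw [h3] at h2
      exact h2
    refine integrable_of_abs_le ?_ hb
    have : StronglyMeasurable (Function.uncurry fun (s t : ℝ) => ‖circleLogKernel (s - t)‖) :=
      Measurable.stronglyMeasurable (by fun_prop)
    exact (this.integral_prod_right (ν := μ)).measurable

/-- `∫∫ ℓ(s − t) d(μ ⊗ μ) = E(μ)`. [folklore] -/
theorem integral_circleLogKernel_prod :
    ∫ p : ℝ × ℝ, circleLogKernel (p.1 - p.2) ∂(μ.prod μ) = circleLogEnergy μ := by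
  rw [integral_prod _ (integrable_circleLogKernel_prod hM hμ)]
  rfl

/-- The pair term `ℓ(θ_i − θ_j)` (`i ≠ j`) is integrable under `μ^{⊗n}` with integral `E(μ)`.
[folklore] -/
theorem integral_circleLogKernel_pi {i j : Fin n} (hij : i ≠ j) :
    Integrable (fun θ : Fin n → ℝ => circleLogKernel (θ i - θ j)) (Measure.pi fun _ : Fin n => μ) ∧
    ∫ θ, circleLogKernel (θ i - θ j) ∂(Measure.pi fun _ : Fin n => μ) = circleLogEnergy μ := by
  have hpair := pi_map_pair μ hij
  have hmeas : AEStronglyMeasurable (fun p : ℝ × ℝ => circleLogKernel (p.1 - p.2))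
      ((Measure.pi fun _ : Fin n => μ).map (fun θ => (θ i, θ j))) :=
    Measurable.aestronglyMeasurable (by fun_prop)
  have hφ : AEMeasurable (fun θ : Fin n → ℝ => (θ i, θ j)) (Measure.pi fun _ : Fin n => μ) :=
    Measurable.aemeasurable (by fun_prop)
  constructor
  · have h := (integrable_map_measure hmeas hφ).1 (by rw [hpair]; exact integrable_circleLogKernel_prod hM hμ)
    exact h
  · rw [← integral_circleLogKernel_prod hM hμ, ← hpair, integral_map hφ hmeas]

omit hM hμ in
/-- The one-body term: `∫ cos θ_j dμ^{⊗n} = ∫ cos dμ`. [folklore] -/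
theorem integral_cos_pi (j : Fin n) :
    ∫ θ, Real.cos (θ j) ∂(Measure.pi fun _ : Fin n => μ) = ∫ t, Real.cos t ∂μ :=
  integral_comp_eval (μ := fun _ : Fin n => μ) (f := Real.cos) Real.continuous_cos.aestronglyMeasurable

/-- The log-Gibbs weight as a function (genuine values off the collision set). [folklore] -/
def logWeight (γ : ℝ) (n : ℕ) (θ : Fin n → ℝ) : ℝ :=
  γ * n * ∑ j, Real.cos (θ j) + ∑ i, ∑ j ∈ ({i}ᶜ : Finset (Fin n)), circleLogKernel (θ i - θ j)

omit hM hμ in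
/-- Off the collision set, the Gibbs weight is `exp (logWeight)`. [folklore] -/
theorem weight_eq_exp_logWeight (γ : ℝ) (θ : Fin n → ℝ) (h : cueWeight n θ ≠ 0) :
    cueWeight n θ * Real.exp (γ * n * ∑ j, Real.cos (θ j)) = Real.exp (logWeight γ n θ) := by
  rw [cueWeight_eq_exp θ h, ← Real.exp_add, logWeight, add_comm]
  congr 1
  congr 1
  rw [← Finset.sum_sum_Ioi_add_eq_sum_sum_off_diag fun i j => circleLogKernel (θ j - θ i)]
  refine Finset.sum_congr rfl fun i _ => Finset.sum_congr rfl fun j _ => ?_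
  rw [circleLogKernel_sub_comm (θ i) (θ j)]; ring

omit hM hμ in
/-- `logWeight` is measurable. [folklore] -/
theorem measurable_logWeight (γ : ℝ) (n : ℕ) : Measurable (logWeight γ n) := by
  unfold logWeight; fun_prop

omit hM hμ in
/-- `logWeight ≤ |γ| n² + n² log 2`. [folklore] -/
theorem logWeight_le (γ : ℝ) (θ : Fin n → ℝ) :
    logWeight γ n θ ≤ |γ| * n ^ 2 + n ^ 2 * Real.log 2 := by
  unfold logWeight
  have h1 : γ * n * ∑ j, Real.cos (θ j) ≤ |γ| * n ^ 2 := by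
    have hs : |∑ j, Real.cos (θ j)| ≤ n := by
      calc |∑ j, Real.cos (θ j)| ≤ ∑ j, |Real.cos (θ j)| := Finset.abs_sum_le_sum_abs _ _
        _ ≤ ∑ _j : Fin n, (1 : ℝ) := Finset.sum_le_sum fun j _ => Real.abs_cos_le_one _
        _ = n := by simp
    calc γ * n * ∑ j, Real.cos (θ j) ≤ |γ * n * ∑ j, Real.cos (θ j)| := le_abs_self _
      _ = |γ| * n * |∑ j, Real.cos (θ j)| := by rw [abs_mul, abs_mul, Nat.abs_cast]
      _ ≤ |γ| * n * n := by gcongr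
      _ = |γ| * n ^ 2 := by ring
  have h2 : ∑ i, ∑ j ∈ ({i}ᶜ : Finset (Fin n)), circleLogKernel (θ i - θ j) ≤ n ^ 2 * Real.log 2 := by
    calc _ ≤ ∑ i, ∑ j ∈ ({i}ᶜ : Finset (Fin n)), Real.log 2 :=
          Finset.sum_le_sum fun i _ => Finset.sum_le_sum fun j _ => circleLogKernel_le_log_two _
      _ ≤ ∑ _i : Fin n, ∑ _j : Fin n, Real.log 2 := by
          refine Finset.sum_le_sum fun i _ => ?_
          exact Finset.sum_le_sum_of_subset_of_nonneg (Finset.subset_univ _)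
            fun _ _ _ => Real.log_nonneg one_le_two
      _ = n ^ 2 * Real.log 2 := by simp [sq]; ring
  linarith

omit hM in
/-- The collision set is `μ^{⊗n}`-null (for `μ ≪ Lebesgue`): a.e. configuration has a
non-vanishing Vandermonde weight. [folklore] -/
theorem ae_cueWeight_ne_zero :
    ∀ᵐ θ ∂(Measure.pi fun _ : Fin n => μ), cueWeight n θ ≠ 0 := by
  have hν := absolutelyContinuous_of_le_smul hμ
  -- for each ordered pair `i ≠ j`, a.e. `e^{i(θ_j - θ_i)} ≠ 1`
  have hpair : ∀ i j : Fin n, i ≠ j →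
      ∀ᵐ θ ∂(Measure.pi fun _ : Fin n => μ), cexp (((θ j - θ i : ℝ) : ℂ) * I) ≠ 1 := by
    intro i j hij
    set D : Set (ℝ × ℝ) := {p | cexp (((p.2 - p.1 : ℝ) : ℂ) * I) = 1} with hD
    have hDm : MeasurableSet D := by
      rw [hD]; exact measurableSet_eq_fun (by fun_prop) (by fun_prop)
    have hD0 : μ.prod μ D = 0 := by
      rw [Measure.measure_prod_null hDm]
      filter_upwards with s
      have : Prod.mk s ⁻¹' D = {t | cexp (((t - s : ℝ) : ℂ) * I) = 1} := by
        ext t; simp [hD]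
      rw [this]
      have h := ae_exp_sub_ne_one hν s
      -- {t | e^{i(t-s)} = 1} = {t | e^{i(s-t)} = 1} up to the symmetry of `exp = 1`
      have hset : {t : ℝ | cexp (((t - s : ℝ) : ℂ) * I) = 1} = {t | cexp (((s - t : ℝ) : ℂ) * I) = 1} := by
        ext t
        simp only [mem_setOf_eq]
        rw [show ((t - s : ℝ) : ℂ) * I = -(((s - t : ℝ) : ℂ) * I) by push_cast; ring,
          Complex.exp_neg, inv_eq_one]
      rw [hset]
      have h' := ae_iff.1 h
      simpa only [not_not, Pi.zero_apply] using h'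
    have hmap := pi_map_pair μ hij
    have hφ : Measurable (fun θ : Fin n → ℝ => (θ i, θ j)) := by fun_prop
    have : (Measure.pi fun _ : Fin n => μ) ((fun θ : Fin n → ℝ => (θ i, θ j)) ⁻¹' D) = 0 := by
      rw [← Measure.map_apply hφ hDm, hmap, hD0]
    rw [ae_iff]
    refine measure_mono_null (fun θ hθ => ?_) this
    simp only [mem_setOf_eq, not_not] at hθ
    simpa [hD] using hθ
  have hall : ∀ᵐ θ ∂(Measure.pi fun _ : Fin n => μ), ∀ i j : Fin n, i ≠ j →
      cexp (((θ j - θ i : ℝ) : ℂ) * I) ≠ 1 := by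
    rw [ae_all_iff]; intro i; rw [ae_all_iff]; intro j
    by_cases hij : i = j
    · exact ae_of_all _ fun θ h => (hij ▸ h : i ≠ i) rfl |>.elim
    · filter_upwards [hpair i j hij] with θ h _ using h
  filter_upwards [hall] with θ hθ
  unfold cueWeight
  refine Finset.prod_ne_zero_iff.2 fun i _ => Finset.prod_ne_zero_iff.2 fun j hj => ?_
  have hij : i ≠ j := (Finset.mem_Ioi.1 hj).ne
  have h := hθ i j hij
  intro h0
  apply h
  rw [norm_exp_sub_exp] at h0
  have h1 : ‖1 - cexp (((θ j - θ i : ℝ) : ℂ) * I)‖ = 0 := pow_eq_zero_iff two_ne_zero |>.1 h0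
  rw [norm_eq_zero, sub_eq_zero] at h1
  exact h1.symm

/-- **Gibbs / Jensen lower bound for the partition function.** For a probability measure
`μ ≤ M · vol|[-π,π]` and every `n`:
`(2π)ⁿ n! · G_n(γ) ≥ M⁻ⁿ exp (γ n² ∫cos dμ + (n² − n) E(μ))`, by Jensen's inequality for `exp`
under the trial state `μ^{⊗n}` (whose density w.r.t. Lebesgue on the box is `≤ Mⁿ`). [folklore] -/
theorem exp_le_gwPartitionFunction (γ : ℝ) (n : ℕ) :
    Real.exp (γ * n * (n * ∫ t, Real.cos t ∂μ) + ((n : ℝ) ^ 2 - n) * circleLogEnergy μ) ≤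
      M ^ n * ((2 * π) ^ n * n.factorial) * gwPartitionFunction n γ := by
  set Q : Measure (Fin n → ℝ) := Measure.pi fun _ : Fin n => μ with hQ
  set P : Measure (Fin n → ℝ) := Measure.pi fun _ : Fin n => volume.restrict (Icc (-π) π) with hP
  set W : (Fin n → ℝ) → ℝ := fun θ => cueWeight n θ * Real.exp (γ * n * ∑ j, Real.cos (θ j)) with hW
  have hMpos : 0 < M := by
    rcases hM.eq_or_lt with h | h
    · exfalso
      have h0 : μ ≤ 0 := by simpa [← h] using hμ
      have h1 : μ Set.univ = 0 := le_antisymm (h0 Set.univ) bot_le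
      simp at h1
    · exact h
  -- Step 1: ∫ S dQ
  have hS_int : Integrable (logWeight γ n) Q := by
    refine Integrable.add ?_ ?_
    · exact integrable_of_forall_abs_le (Q := Q) (by fun_prop) (C := |γ * n| * n) fun θ => by
        rw [abs_mul (γ * n)]
        exact mul_le_mul_of_nonneg_left (abs_sum_cos_le θ) (abs_nonneg _)
    · refine integrable_finsetSum _ fun i _ => integrable_finsetSum _ fun j hj => ?_
      have hij : i ≠ j := fun h => by simp [h] at hj
      exact (integral_circleLogKernel_pi hM hμ hij).1
  have hS_val : ∫ θ, logWeight γ n θ ∂Q =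
      γ * n * (n * ∫ t, Real.cos t ∂μ) + ((n : ℝ) ^ 2 - n) * circleLogEnergy μ := by
    unfold logWeight
    rw [MeasureTheory.integral_add, MeasureTheory.integral_const_mul, MeasureTheory.integral_finsetSum,
      MeasureTheory.integral_finsetSum]
    · congr 1
      · rw [hQ]; simp_rw [integral_cos_pi (μ := μ)]; simp
      · rw [show ((n : ℝ) ^ 2 - n) * circleLogEnergy μ =
            ∑ i : Fin n, ∑ _j ∈ ({i}ᶜ : Finset (Fin n)), circleLogEnergy μ by
          simp only [Finset.sum_const, nsmul_eq_mul, Finset.card_univ, Fintype.card_fin,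
            Finset.card_compl, Finset.card_singleton]
          rcases Nat.eq_zero_or_pos n with rfl | hn
          · simp
          · rw [Nat.cast_sub hn]; push_cast; ring]
        refine Finset.sum_congr rfl fun i _ => ?_
        rw [MeasureTheory.integral_finsetSum]
        · refine Finset.sum_congr rfl fun j hj => ?_
          have hij : i ≠ j := fun h => by simp [h] at hj
          exact (integral_circleLogKernel_pi hM hμ hij).2
        · intro j hj
          have hij : i ≠ j := fun h => by simp [h] at hj
          exact (integral_circleLogKernel_pi hM hμ hij).1
    · intro i _
      refine integrable_finsetSum _ fun j hj => ?_
      have hij : i ≠ j := fun h => by simp [h] at hj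
      exact (integral_circleLogKernel_pi hM hμ hij).1
    · intro j _
      exact integrable_of_forall_abs_le (Q := Q) (by fun_prop) fun θ => Real.abs_cos_le_one _
    · exact (integrable_of_forall_abs_le (Q := Q) (by fun_prop) (C := n) (abs_sum_cos_le)).const_mul _
    · refine integrable_finsetSum _ fun i _ => integrable_finsetSum _ fun j hj => ?_
      have hij : i ≠ j := fun h => by simp [h] at hj
      exact (integral_circleLogKernel_pi hM hμ hij).1
  -- Step 2: Jensen
  have hexpS_int : Integrable (fun θ => Real.exp (logWeight γ n θ)) Q := by
    refine integrable_of_forall_abs_le (Q := Q) ((measurable_logWeight γ n).exp)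
      (C := Real.exp (|γ| * n ^ 2 + n ^ 2 * Real.log 2)) fun θ => ?_
    rw [abs_of_nonneg (Real.exp_nonneg _)]
    exact Real.exp_le_exp.2 (logWeight_le γ θ)
  have hJ : Real.exp (∫ θ, logWeight γ n θ ∂Q) ≤ ∫ θ, Real.exp (logWeight γ n θ) ∂Q :=
    (convexOn_exp).map_integral_le Real.continuous_exp.continuousOn isClosed_univ
      (ae_of_all _ fun θ => mem_univ _) hS_int hexpS_int
  -- Step 3: exp S = W  Q-a.e., and ∫ W dQ ≤ M^n ∫ W dP
  have hW_eq : (fun θ => Real.exp (logWeight γ n θ)) =ᵐ[Q] W := by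
    filter_upwards [ae_cueWeight_ne_zero (n := n) hμ] with θ hθ
    rw [hW]; exact (weight_eq_exp_logWeight γ θ hθ).symm
  have hW_cont : Continuous W := by
    rw [hW]; unfold cueWeight; fun_prop
  have hW_bdd : ∀ θ, |W θ| ≤ 4 ^ (n * n) * Real.exp (|γ| * n * n) := by
    intro θ
    rw [hW]; dsimp only
    rw [abs_of_nonneg (mul_nonneg (cueWeight_nonneg n θ) (Real.exp_nonneg _))]
    refine mul_le_mul ?_ ?_ (Real.exp_nonneg _) (by positivity)
    · unfold cueWeight
      calc ∏ i, ∏ j ∈ Finset.Ioi i, ‖cexp (θ i * I) - cexp (θ j * I)‖ ^ 2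
          ≤ ∏ i, ∏ _j ∈ Finset.Ioi i, (4 : ℝ) := by
            refine Finset.prod_le_prod (fun i _ => by positivity) fun i _ => ?_
            refine Finset.prod_le_prod (fun j _ => by positivity) fun j _ => ?_
            have : ‖cexp (θ i * I) - cexp (θ j * I)‖ ≤ 2 := by
              calc _ ≤ ‖cexp (θ i * I)‖ + ‖cexp (θ j * I)‖ := norm_sub_le _ _
                _ = 2 := by rw [Complex.norm_exp_ofReal_mul_I, Complex.norm_exp_ofReal_mul_I]; norm_num
            nlinarith [norm_nonneg (cexp (θ i * I) - cexp (θ j * I))]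
        _ ≤ 4 ^ (n * n) := by
            simp only [Finset.prod_const, Finset.prod_pow_eq_pow_sum]
            refine pow_le_pow_right₀ (by norm_num) ?_
            calc ∑ i : Fin n, (Finset.Ioi i).card ≤ ∑ _i : Fin n, n :=
                  Finset.sum_le_sum fun i _ => (Finset.card_le_univ _).trans_eq (Fintype.card_fin n)
              _ = n * n := by simp
    · refine Real.exp_le_exp.2 ?_
      have hs := abs_sum_cos_le θ
      calc γ * n * ∑ j, Real.cos (θ j) ≤ |γ * n * ∑ j, Real.cos (θ j)| := le_abs_self _
        _ = |γ| * n * |∑ j, Real.cos (θ j)| := by rw [abs_mul, abs_mul, Nat.abs_cast]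
        _ ≤ |γ| * n * n := by gcongr
  haveI : IsFiniteMeasure P := by rw [hP]; infer_instance
  have hW_intP : Integrable W ((ENNReal.ofReal M) ^ n • P) :=
    (integrable_of_forall_abs_le (Q := P) hW_cont.measurable hW_bdd).smul_measure
      (ENNReal.pow_ne_top ENNReal.ofReal_ne_top)
  have hcomp : ∫ θ, W θ ∂Q ≤ M ^ n * ∫ θ, W θ ∂P := by
    have h := integral_mono_measure (pi_le_smul_pi hμ n)
      (ae_of_all _ fun θ => mul_nonneg (cueWeight_nonneg n θ) (Real.exp_nonneg _)) hW_intP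
    rw [MeasureTheory.integral_smul_measure, ENNReal.toReal_pow, ENNReal.toReal_ofReal hM,
      smul_eq_mul] at h
    exact h
  -- Step 4: ∫ W dP is the box integral
  have hbox : ∫ θ, W θ ∂P = ∫ θ in eigenBox n, W θ := by
    rw [hP, eigenBox, ← Measure.restrict_pi_pi, ← volume_pi]
  have hG : ∫ θ in eigenBox n, W θ = ((2 * π) ^ n * n.factorial) * gwPartitionFunction n γ := by
    unfold gwPartitionFunction
    rw [← mul_assoc, mul_inv_cancel₀ (by positivity), one_mul]
  -- assemble
  calc Real.exp (γ * n * (n * ∫ t, Real.cos t ∂μ) + ((n : ℝ) ^ 2 - n) * circleLogEnergy μ)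
      = Real.exp (∫ θ, logWeight γ n θ ∂Q) := by rw [hS_val]
    _ ≤ ∫ θ, Real.exp (logWeight γ n θ) ∂Q := hJ
    _ = ∫ θ, W θ ∂Q := integral_congr_ae hW_eq
    _ ≤ M ^ n * ∫ θ, W θ ∂P := hcomp
    _ = M ^ n * ((2 * π) ^ n * n.factorial) * gwPartitionFunction n γ := by
        rw [hbox, hG]; ring

/-- The partition function is positive. [folklore] -/
theorem gwPartitionFunction_pos (γ : ℝ) (n : ℕ) : 0 < gwPartitionFunction n γ := by
  have h := exp_le_gwPartitionFunction hM hμ γ n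
  have hMpos : 0 < M := by
    rcases hM.eq_or_lt with h' | h'
    · exfalso
      have h0 : μ ≤ 0 := by simpa [← h'] using hμ
      have h1 : μ Set.univ = 0 := le_antisymm (h0 Set.univ) bot_le
      simp at h1
    · exact h'
  have hc : 0 < M ^ n * ((2 * π) ^ n * n.factorial) := by positivity
  by_contra hneg
  push Not at hneg
  have : M ^ n * ((2 * π) ^ n * ↑n.factorial) * gwPartitionFunction n γ ≤ 0 :=
    mul_nonpos_of_nonneg_of_nonpos hc.le hneg
  linarith [Real.exp_pos (γ * n * (n * ∫ t, Real.cos t ∂μ) + ((n : ℝ) ^ 2 - n) * circleLogEnergy μ)]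

/-- **Lower bound for the free energy per particle pair**: for `n ≥ 1`,
`f_n(γ) ≥ γ ∫cos dμ + (1 − 1/n) E(μ) − (log M + log (2π))/n − (log n!)/n²`. [folklore] -/
theorem le_gwFreeEnergyN (γ : ℝ) {n : ℕ} (hn : 1 ≤ n) :
    γ * (∫ t, Real.cos t ∂μ) + (1 - 1 / n) * circleLogEnergy μ
      - (Real.log M + Real.log (2 * π)) / n - Real.log n.factorial / n ^ 2 ≤ gwFreeEnergyN n γ := by
  have h := exp_le_gwPartitionFunction hM hμ γ n
  have hpos := gwPartitionFunction_pos hM hμ γ n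
  have hMpos : 0 < M := by
    rcases hM.eq_or_lt with h' | h'
    · exfalso
      have h0 : μ ≤ 0 := by simpa [← h'] using hμ
      have h1 : μ Set.univ = 0 := le_antisymm (h0 Set.univ) bot_le
      simp at h1
    · exact h'
  have hn' : (0 : ℝ) < n := by exact_mod_cast hn
  have hlog := Real.log_le_log (Real.exp_pos _) h
  rw [Real.log_exp, Real.log_mul (by positivity) hpos.ne', Real.log_mul (by positivity) (by positivity),
    Real.log_mul (by positivity) (by positivity), Real.log_pow, Real.log_pow] at hlog
  unfold gwFreeEnergyN
  rw [le_div_iff₀ (by positivity)]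
  have : (γ * ∫ t, Real.cos t ∂μ + (1 - 1 / ↑n) * circleLogEnergy μ - (Real.log M + Real.log (2 * π)) / ↑n -
      Real.log ↑n.factorial / ↑n ^ 2) * ↑n ^ 2 =
      γ * n * (n * ∫ t, Real.cos t ∂μ) + ((n : ℝ) ^ 2 - n) * circleLogEnergy μ
        - (n * Real.log M + n * Real.log (2 * π) + Real.log n.factorial) := by
    field_simp
    ring
  rw [this]
  linarith

end LowerBound

/-! ### The mean-field limit given Frostman data -/

section Limit

/-- `log n! / n² → 0`. [folklore] -/
theorem tendsto_log_factorial_div_sq :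
    Tendsto (fun n : ℕ => Real.log n.factorial / (n : ℝ) ^ 2) atTop (𝓝 0) := by
  have hlog : Tendsto (fun n : ℕ => Real.log n / n) atTop (𝓝 0) :=
    (Real.isLittleO_log_id_atTop.tendsto_div_nhds_zero).comp tendsto_natCast_atTop_atTop
  refine squeeze_zero' (Eventually.of_forall fun n => by positivity) ?_ hlog
  filter_upwards [eventually_ge_atTop 1] with n hn
  have hn' : (0 : ℝ) < n := by exact_mod_cast hn
  have h1 : Real.log n.factorial ≤ n * Real.log n := by
    rw [← Real.log_pow]
    exact Real.log_le_log (by exact_mod_cast Nat.factorial_pos n) (by exact_mod_cast Nat.factorial_le_pow n)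
  calc Real.log n.factorial / (n : ℝ) ^ 2 ≤ n * Real.log n / (n : ℝ) ^ 2 := by gcongr
    _ = Real.log n / n := by field_simp

/-- `log (n+1) / n → 0`. [folklore] -/
theorem tendsto_log_succ_div :
    Tendsto (fun n : ℕ => Real.log (n + 1) / n) atTop (𝓝 0) := by
  have h1 : Tendsto (fun n : ℕ => Real.log ((n : ℝ) + 1) / ((n : ℝ) + 1)) atTop (𝓝 0) := by
    have := (Real.isLittleO_log_id_atTop.tendsto_div_nhds_zero).comp
      (tendsto_natCast_atTop_atTop.comp (tendsto_add_atTop_nat 1))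
    refine this.congr fun n => ?_
    simp
  have h2 : Tendsto (fun n : ℕ => ((n : ℝ) + 1) / n) atTop (𝓝 1) := by
    have : Tendsto (fun n : ℕ => 1 + 1 / (n : ℝ)) atTop (𝓝 (1 + 0)) :=
      tendsto_const_nhds.add tendsto_one_div_atTop_nhds_zero_nat
    rw [add_zero] at this
    refine this.congr' ?_
    filter_upwards [eventually_ge_atTop 1] with n hn
    have hn' : (n : ℝ) ≠ 0 := by exact_mod_cast (Nat.one_le_iff_ne_zero.1 hn)
    field_simp
  have := h1.mul h2
  rw [zero_mul] at this
  refine this.congr' ?_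
  filter_upwards [eventually_ge_atTop 1] with n hn
  have hn' : (n : ℝ) ≠ 0 := by exact_mod_cast (Nat.one_le_iff_ne_zero.1 hn)
  have hn1 : (n : ℝ) + 1 ≠ 0 := by positivity
  field_simp

/-- The regularisation schedule `r_n = n/(n+1) ↑ 1`. [folklore] -/
theorem tendsto_regularisation :
    Tendsto (fun n : ℕ => (n : ℝ) / (n + 1)) atTop (𝓝[<] 1) := by
  rw [tendsto_nhdsWithin_iff]
  constructor
  · have : Tendsto (fun n : ℕ => 1 - 1 / ((n : ℝ) + 1)) atTop (𝓝 (1 - 0)) :=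
      tendsto_const_nhds.sub (tendsto_one_div_add_atTop_nhds_zero_nat)
    rw [sub_zero] at this
    refine this.congr fun n => ?_
    have hn1 : (n : ℝ) + 1 ≠ 0 := by positivity
    field_simp
    ring
  · refine Eventually.of_forall fun n => ?_
    rw [mem_Iio, div_lt_one (by positivity)]
    exact lt_add_one _

/-- **Mean-field (Coulomb-gas) limit of the Gross–Witten free energy, given Frostman data**:
`f_n(γ) = n⁻² log G_n(γ) → F(μ) = γ ∫cos dμ + E(μ)` — the lower bound by Gibbs' principle with
the trial state `μ^{⊗n}`, the upper bound by Frostman's inequality with regularisation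
`r_n = n/(n+1)`. [folklore] -/
theorem GWFrostmanData.tendsto_gwFreeEnergyN (d : GWFrostmanData γ) :
    Tendsto (fun n : ℕ => gwFreeEnergyN n γ) atTop (𝓝 d.freeEnergy) := by
  haveI := d.isProb
  have hM := d.M_pos
  -- lower envelope
  set L : ℕ → ℝ := fun n => d.freeEnergy - circleLogEnergy d.μ / n
      - (Real.log d.M + Real.log (2 * π)) / n - Real.log n.factorial / (n : ℝ) ^ 2 with hL
  -- upper envelope
  set U : ℕ → ℝ := fun n => d.freeEnergy + 2 * d.M * circleLogExcess ((n : ℝ) / (n + 1))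
      + 2 * Real.log (((n : ℝ) / (n + 1))⁻¹) + Real.log ((1 - (n : ℝ) / (n + 1))⁻¹) / n with hU
  have hLt : Tendsto L atTop (𝓝 d.freeEnergy) := by
    have h1 : Tendsto (fun n : ℕ => circleLogEnergy d.μ / n) atTop (𝓝 0) :=
      tendsto_const_div_atTop_nhds_zero_nat _
    have h2 : Tendsto (fun n : ℕ => (Real.log d.M + Real.log (2 * π)) / n) atTop (𝓝 0) :=
      tendsto_const_div_atTop_nhds_zero_nat _
    have := (((tendsto_const_nhds (x := d.freeEnergy)).sub h1).sub h2).sub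
      tendsto_log_factorial_div_sq
    simpa [hL] using this
  have hUt : Tendsto U atTop (𝓝 d.freeEnergy) := by
    have h1 : Tendsto (fun n : ℕ => 2 * d.M * circleLogExcess ((n : ℝ) / (n + 1))) atTop (𝓝 0) := by
      have := (tendsto_circleLogExcess.comp tendsto_regularisation).const_mul (2 * d.M)
      simpa using this
    have h2 : Tendsto (fun n : ℕ => 2 * Real.log (((n : ℝ) / (n + 1))⁻¹)) atTop (𝓝 0) := by
      have hr : Tendsto (fun n : ℕ => ((n : ℝ) / (n + 1))⁻¹) atTop (𝓝 1⁻¹) :=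
        (tendsto_nhdsWithin_iff.1 tendsto_regularisation).1.inv₀ one_ne_zero
      rw [inv_one] at hr
      have := (hr.log one_ne_zero).const_mul 2
      simpa using this
    have h3 : Tendsto (fun n : ℕ => Real.log ((1 - (n : ℝ) / (n + 1))⁻¹) / n) atTop (𝓝 0) := by
      refine tendsto_log_succ_div.congr' ?_
      filter_upwards [eventually_ge_atTop 1] with n hn
      have hn1 : (n : ℝ) + 1 ≠ 0 := by positivity
      congr 2
      field_simp
      ring
    have := (((tendsto_const_nhds (x := d.freeEnergy)).add h1).add h2).add h3
    simpa [hU] using this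
  refine tendsto_of_tendsto_of_tendsto_of_le_of_le' hLt hUt ?_ ?_
  · filter_upwards [eventually_ge_atTop 1] with n hn
    have h := le_gwFreeEnergyN hM.le d.le_smul γ hn
    rw [hL]; dsimp only
    have : d.freeEnergy - circleLogEnergy d.μ / ↑n =
        γ * (∫ t, Real.cos t ∂d.μ) + (1 - 1 / n) * circleLogEnergy d.μ := by
      unfold GWFrostmanData.freeEnergy; ring
    rw [this]; exact h
  · filter_upwards [eventually_ge_atTop 1] with n hn
    have hr0 : (0 : ℝ) < n / (n + 1) := by
      have : (0 : ℝ) < n := by exact_mod_cast hn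
      positivity
    have hr1 : (n : ℝ) / (n + 1) < 1 := by rw [div_lt_one (by positivity)]; exact lt_add_one _
    exact gwFreeEnergyN_le d hn (gwPartitionFunction_pos hM.le d.le_smul γ n) hr0 hr1

end Limit

end Literature.Barriers.QuantumFields
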